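import Mathlib.Algebra.Category.ModuleCat.Basic
import Mathlib.Algebra.DirectSum.Module
import Mathlib.LinearAlgebra.TensorProduct.Tower
import Mathlib.Algebra.BigOperators.Finprod
import Mathlib.Data.Finset.NatAntidiagonal
import Mathlib.AlgebraicGeometry.AlgebraicCycle.Basic
import Mathlib.AlgebraicGeometry.Pullbacks
import Literature.AlgebraicGeometry.Motives.Varieties
import Literature.AlgebraicGeometry.Motives.Cycles
import HarnessLib

-- provenance: harness21/H21/H21/Prelude/MotiveAbstract/PreWeilCohomology.lean @ 0b043ee (interim HEAD d8f2665); M5 mechanical rewrite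
/-!
# The data of a Weil cohomology theory (trunk MotiveAbstract, prelude C8)

Following Kleiman, *Algebraic cycles and the Weil conjectures* (1968), §1.2 (compare Stacks 0FFG),
a Weil cohomology theory on smooth projective `k`-varieties with coefficients in a field `K` is a
contravariant functor `X ↦ H•(X) = ⨁ Hⁱ(X)` to graded-commutative `K`-algebras, with a trace
`H²ⁿ(X) → K` (Poincaré duality), a Künneth isomorphism and a cycle class map, subject to axioms.

This file records only the **data** (`Literature.PreWeilCohomology k K`: the functors `Hⁱ`, cup products,
unit, trace, cycle classes of prime cycles) and the derived vocabulary needed to *state* the axioms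
(`Literature.AlgebraicGeometry.Motives.WeilCohomology`, item C9) and the standard conjectures (Lefschetz operators, algebraic
classes, correspondences "inducing" linear maps, graded algebraic operators). Everything here is a
total definition; no axiom of a Weil cohomology theory is assumed.

## Main definitions (all in `namespace Literature.PreWeilCohomology`, `W : PreWeilCohomology k K`)

* `W.obj X i` : the `K`-vector space `Hⁱ(X)`; `W.pullback f i = f* : Hⁱ(Y) → Hⁱ(X)`.
* `W.cupPairing X n i j h` : `(x, y) ↦ tr_X (x ∪ y)` for `i + j = 2n` (Kleiman §1.2 (A)).
* `W.pow X η r = ηʳ ∈ H²ʳ(X)`, `W.lefschetzPow X η r i j h = Lʳ = (· ∪ ηʳ) : Hⁱ(X) → Hʲ(X)`,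
  `W.lefschetzOp X η` (the Lefschetz operator `L` as a graded operator; Kleiman §1.4).
* `W.externalCup`, `W.kunnethMap X Y n : ⨁_{i+j=n} Hⁱ(X) ⊗ Hʲ(Y) → Hⁿ(X × Y)` (Kleiman §1.2 (B)).
* `W.cycleMap X p : Zᵖ(X) → H²ᵖ(X)` extended by linearity from `W.cycleClass`,
  `W.algebraicLattice X p` (its image on codimension-`p` cycles), `W.ratAlgebraicClasses X p` (the
  divisible hull, i.e. classes of `ℚ`-cycles), `W.algebraicClasses X p` (the `K`-span)
  (Kleiman §1.2 (C), §1.4).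
* `W.IsInducedBy nX nY u T` : the linear map `T : Hⁱ(X) → Hʲ(Y)` is induced by the correspondence
  `u ∈ Hᵐ(X × Y)`, in Kleiman's pairing form `tr_Y (T x ∪ y) = tr_{X×Y} ((pr₁* x ∪ u) ∪ pr₂* y)`
  (Kleiman §1.3). Relational: no Poincaré duality is needed to state it.
* `W.IsHyperplaneClass X η`, `W.transposeClass`, `W.GradedOp X Y`, `W.IsAlgebraicGradedOp`,
  `W.IsAlgebraicOperator` (Kleiman §1.4, §2).

## Design choices

* Universes: `k : Type u`, `K : Type v`, and `Hⁱ(X) : ModuleCat.{u} K` lives in the universe of the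
  schemes. All maps are `K`-linear maps between the carriers `W.obj X i` of `ModuleCat` objects.
* Degrees are natural numbers and degree constraints are explicit equations `h : i + j = n`
  (cast-free bookkeeping, as in Mathlib's graded objects), never `ℕ`-subtraction.
* Mathlib has no Weil cohomology theory (searched `WeilCohomology`, `cycleClass`, `Kunneth`,
  `Lefschetz` in `Mathlib/AlgebraicGeometry`: nothing relevant); we use Mathlib's `ModuleCat`,
  `TensorProduct`, `DirectSum.toModule`, `Finset.antidiagonal`, `AlgebraicCycle`, and the cartesian
  monoidal structure on `Over (Spec k)` (`fst`, `snd`, braiding `β_`).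
* Junk values: `W.cycleMap` is a `finsum` (value `0` if the support is infinite; it is finite on
  quasi-compact schemes, `finite_support_cycleMap`); `GradedOp.comp` is a `finsum` over the middle
  degree (finite as soon as `Hᵐ(Y) = 0` for `m ≫ 0`, which is axiom (A) of C9).

## References

* S. Kleiman, *Algebraic cycles and the Weil conjectures*, in: Dix exposés sur la cohomologie des
  schémas (1968), §§1.2–1.4, §2.
* A. Grothendieck, *Standard conjectures on algebraic cycles* (1969).
* The Stacks project, Tag 0FFG (Weil cohomology theories).
-/

universe u v

open CategoryTheory AlgebraicGeometry MonoidalCategory CartesianMonoidalCategory Opposite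
open scoped TensorProduct DirectSum

noncomputable section

namespace Literature.AlgebraicGeometry.Motives

/-- The **data** of a Weil cohomology theory on `k`-schemes with coefficients in the field `K`
(Kleiman 1968, §1.2): graded contravariant functors `Hⁱ : (Sch/k)ᵒᵖ ⥤ Vect_K`, cup products
`Hⁱ(X) ⊗ Hʲ(X) → Hⁱ⁺ʲ(X)`, a unit `1 ∈ H⁰(X)`, trace maps `H²ⁿ(X) → K` (meaningful for
`n = dim X`) and the cohomology class `cycleClass X p z ∈ H²ᵖ(X)` of the prime cycle `closure {z}`
(meaningful for `z` of codimension `p`). No axioms are imposed here; see `Literature.AlgebraicGeometry.Motives.WeilCohomology`. [cite: Kleiman1968, §1.2] -/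
structure PreWeilCohomology (k : Type u) [Field k] (K : Type v) [Field K] where
  /-- The cohomology functors `Hⁱ : (Sch/k)ᵒᵖ ⥤ Mod_K`. -/
  H : ℕ → (SchemeOver k)ᵒᵖ ⥤ ModuleCat.{u} K
  /-- The cup product `Hⁱ(X) →ₗ Hʲ(X) →ₗ Hⁿ(X)` for `i + j = n`. -/
  cup {X : SchemeOver k} {i j n : ℕ} (h : i + j = n) :
    (H i).obj (op X) →ₗ[K] (H j).obj (op X) →ₗ[K] (H n).obj (op X)
  /-- The unit `1 ∈ H⁰(X)`. -/
  one (X : SchemeOver k) : (H 0).obj (op X)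
  /-- The trace map `H²ⁿ(X) →ₗ K` (the orientation; meaningful for `n = dim X`). -/
  trace (X : SchemeOver k) (n : ℕ) : (H (2 * n)).obj (op X) →ₗ[K] K
  /-- The cohomology class in `H²ᵖ(X)` of the prime cycle with generic point `z`
  (meaningful when `Order.coheight z = p`). -/
  cycleClass (X : SchemeOver k) (p : ℕ) : X.left → (H (2 * p)).obj (op X)

namespace PreWeilCohomology

variable {k : Type u} [Field k] {K : Type v} [Field K] (W : PreWeilCohomology k K)

/-- The `K`-vector space `Hⁱ(X)` of a pre-Weil cohomology theory (Kleiman §1.2). [folklore] -/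
abbrev obj (X : SchemeOver k) (i : ℕ) : Type u := (W.H i).obj (op X)

section Functoriality

variable {X Y Z : SchemeOver k}

/-- Pull-back `f* : Hⁱ(Y) →ₗ Hⁱ(X)` along a `k`-morphism `f : X ⟶ Y` (Kleiman §1.2). [folklore] -/
def pullback (f : X ⟶ Y) (i : ℕ) : W.obj Y i →ₗ[K] W.obj X i := ((W.H i).map f.op).hom

/-- `(𝟙 X)* = id`. [folklore] -/
@[simp]
lemma pullback_id (i : ℕ) : W.pullback (𝟙 X) i = LinearMap.id := by
  rw [pullback, op_id, (W.H i).map_id]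
  rfl

/-- `(f ≫ g)* = f* ∘ g*`. [folklore] -/
lemma pullback_comp (f : X ⟶ Y) (g : Y ⟶ Z) (i : ℕ) :
    W.pullback (f ≫ g) i = (W.pullback f i).comp (W.pullback g i) := by
  rw [pullback, op_comp, (W.H i).map_comp]
  rfl

end Functoriality

section Products

variable (X : SchemeOver k)

/-- The cup-product pairing `Hⁱ(X) × Hʲ(X) → K`, `(x, y) ↦ tr_X (x ∪ y)`, for `i + j = 2n`
(`n = dim X`); Poincaré duality (Kleiman §1.2 (A)) asks that it be perfect. [folklore] -/
def cupPairing (n i j : ℕ) (h : i + j = 2 * n) : W.obj X i →ₗ[K] W.obj X j →ₗ[K] K :=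
  (W.cup h).compr₂ (W.trace X n)

/-- Powers `ηʳ ∈ H²ʳ(X)` of a class `η ∈ H²(X)`: `η⁰ = 1`, `ηʳ⁺¹ = ηʳ ∪ η` (Kleiman §1.4). [folklore] -/
def pow (η : W.obj X 2) : (r : ℕ) → W.obj X (2 * r)
  | 0 => W.one X
  | r + 1 => W.cup rfl (pow η r) η

/-- `η⁰ = 1`. [folklore] -/
@[simp]
lemma pow_zero (η : W.obj X 2) : W.pow X η 0 = W.one X := rfl

/-- `ηʳ⁺¹ = ηʳ ∪ η`. [folklore] -/
lemma pow_succ (η : W.obj X 2) (r : ℕ) :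
    W.pow X η (r + 1) = W.cup rfl (W.pow X η r) η := rfl

/-- The iterated Lefschetz operator `Lʳ : Hⁱ(X) →ₗ Hʲ(X)`, `x ↦ x ∪ ηʳ`, for `i + 2r = j`
(Kleiman §1.4; hard Lefschetz concerns `Lⁿ⁻ⁱ : Hⁱ → H²ⁿ⁻ⁱ`). [folklore] -/
def lefschetzPow (η : W.obj X 2) (r i j : ℕ) (h : i + 2 * r = j) : W.obj X i →ₗ[K] W.obj X j :=
  (W.cup h).flip (W.pow X η r)

variable (Y : SchemeOver k)

/-- The external cup product `Hⁱ(X) →ₗ Hʲ(Y) →ₗ Hⁿ(X × Y)`, `(x, y) ↦ pr₁* x ∪ pr₂* y`, for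
`i + j = n` (Kleiman §1.2 (B)). [folklore] -/
def externalCup {i j n : ℕ} (h : i + j = n) : W.obj X i →ₗ[K] W.obj Y j →ₗ[K] W.obj (X ⊗ Y) n :=
  ((W.cup h).comp (W.pullback (fst X Y) i)).compl₂ (W.pullback (snd X Y) j)

/-- The Künneth map `⨁_{i+j=n} Hⁱ(X) ⊗ Hʲ(Y) →ₗ Hⁿ(X × Y)` induced by the external cup products;
the Künneth axiom (Kleiman §1.2 (B)) asks that it be bijective. [folklore] -/
noncomputable def kunnethMap (n : ℕ) :
    (⨁ ij : ↥(Finset.antidiagonal n), W.obj X ij.1.1 ⊗[K] W.obj Y ij.1.2) →ₗ[K]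
      W.obj (X ⊗ Y) n :=
  DirectSum.toModule K _ _ fun ij ↦
    TensorProduct.lift (W.externalCup X Y (Finset.mem_antidiagonal.mp ij.2))

/-- The transpose of a correspondence: pull-back of `u ∈ Hᵐ(X × Y)` along the swap
`Y × X ≅ X × Y` (Kleiman §1.3). [folklore] -/
def transposeClass {X Y} {m : ℕ} (u : W.obj (X ⊗ Y) m) : W.obj (Y ⊗ X) m :=
  W.pullback (β_ Y X).hom m u

end Products

/-! ## Cycle classes and algebraic cohomology classes -/

section Cycles

variable (X : SchemeOver k) (p : ℕ)

/-- The cycle class map `Zᵖ(X) → H²ᵖ(X)`, `c ↦ ∑_z c(z) • cl(closure {z})`, extending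
`W.cycleClass` by `ℤ`-linearity (Kleiman §1.2 (C)). Junk value `0` if the support of `c` is
infinite (it is finite on quasi-compact `X`, `finite_support_cycleMap`); meaningful on
codimension-`p` cycles. [folklore] -/
def cycleMap (c : AlgebraicCycle X.left ℤ) : W.obj X (2 * p) :=
  ∑ᶠ z, c z • W.cycleClass X p z

/-- On a quasi-compact scheme the sum defining `W.cycleMap` is finite. [folklore] -/
lemma finite_support_cycleMap [CompactSpace X.left] (c : AlgebraicCycle X.left ℤ) :
    (Function.support fun z ↦ c z • W.cycleClass X p z).Finite := by
  have h : (Function.support c).Finite := by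
    simpa using c.locallyFiniteSupport.finite_inter_support_of_isCompact isCompact_univ
  exact h.subset (Function.support_smul_subset_left (⇑c) (W.cycleClass X p))

/-- `cycleMap 0 = 0`. [folklore] -/
@[simp]
lemma cycleMap_zero : W.cycleMap X p 0 = 0 := by
  simp [cycleMap]

/-- `W.cycleMap` is additive on a quasi-compact scheme. [folklore] -/
lemma cycleMap_add [CompactSpace X.left] (c c' : AlgebraicCycle X.left ℤ) :
    W.cycleMap X p (c + c') = W.cycleMap X p c + W.cycleMap X p c' := by
  simp only [cycleMap, Function.locallyFinsuppWithin.coe_add, Pi.add_apply, add_smul]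
  exact finsum_add_distrib (W.finite_support_cycleMap X p c) (W.finite_support_cycleMap X p c')

/-- The lattice `Aᵖ(X) ⊆ H²ᵖ(X)` of algebraic cohomology classes: the subgroup generated by the
classes of prime cycles of codimension `p` (Kleiman §1.2 (C), §1.4). [folklore] -/
def algebraicLattice : AddSubgroup (W.obj X (2 * p)) :=
  AddSubgroup.closure
    (Set.range fun z : {z : X.left // Order.coheight z = p} ↦ W.cycleClass X p z)

/-- The group `Aᵖ(X) ⊗ ℚ ⊆ H²ᵖ(X)` of classes of algebraic cycles with rational coefficients,
realised as the divisible hull `{x | ∃ N ≠ 0, N • x ∈ Aᵖ(X)}` of the algebraic lattice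
(Kleiman §1.4, "algebraic" means with `ℚ`-coefficients in the standard conjectures). [folklore] -/
def ratAlgebraicClasses : AddSubgroup (W.obj X (2 * p)) where
  carrier := {x | ∃ N : ℤ, N ≠ 0 ∧ N • x ∈ W.algebraicLattice X p}
  zero_mem' := ⟨1, one_ne_zero, by simp⟩
  add_mem' := by
    rintro x y ⟨N, hN, hx⟩ ⟨M, hM, hy⟩
    refine ⟨N * M, mul_ne_zero hN hM, ?_⟩
    rw [smul_add, mul_comm N M, mul_smul, mul_comm M N, mul_smul]
    exact add_mem (AddSubgroup.zsmul_mem _ hx M) (AddSubgroup.zsmul_mem _ hy N)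
  neg_mem' := by
    rintro x ⟨N, hN, hx⟩
    exact ⟨N, hN, by simpa using neg_mem hx⟩

/-- Membership in `W.ratAlgebraicClasses`, unfolded. [folklore] -/
lemma mem_ratAlgebraicClasses_iff {x : W.obj X (2 * p)} :
    x ∈ W.ratAlgebraicClasses X p ↔ ∃ N : ℤ, N ≠ 0 ∧ N • x ∈ W.algebraicLattice X p := Iff.rfl

/-- The `K`-subspace of `H²ᵖ(X)` spanned by algebraic classes (Kleiman §1.4). [folklore] -/
def algebraicClasses : Submodule K (W.obj X (2 * p)) :=
  Submodule.span K (W.algebraicLattice X p)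

/-- `Aᵖ(X) ⊆ Aᵖ(X) ⊗ ℚ`. [folklore] -/
lemma algebraicLattice_le_ratAlgebraicClasses :
    W.algebraicLattice X p ≤ W.ratAlgebraicClasses X p :=
  fun _ hx ↦ ⟨1, one_ne_zero, by simpa using hx⟩

/-- `Aᵖ(X) ⊆ K · Aᵖ(X)`. [folklore] -/
lemma algebraicLattice_le_algebraicClasses :
    W.algebraicLattice X p ≤ (W.algebraicClasses X p).toAddSubgroup :=
  fun _ hx ↦ Submodule.subset_span hx

/-- In characteristic zero, `Aᵖ(X) ⊗ ℚ ⊆ K · Aᵖ(X)`. [folklore] -/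
lemma ratAlgebraicClasses_le_algebraicClasses [CharZero K] :
    W.ratAlgebraicClasses X p ≤ (W.algebraicClasses X p).toAddSubgroup := by
  rintro x ⟨N, hN, hx⟩
  have hNK : (N : K) ≠ 0 := Int.cast_ne_zero.mpr hN
  have : x = (N : K)⁻¹ • ((N : K) • x) := by rw [smul_smul, inv_mul_cancel₀ hNK, one_smul]
  rw [this]
  refine Submodule.smul_mem _ _ ?_
  rw [Int.cast_smul_eq_zsmul]
  exact Submodule.subset_span hx

/-- The class of the prime cycle of a codimension-`p` point is algebraic. [folklore] -/
lemma cycleClass_mem_algebraicLattice {z : X.left} (hz : Order.coheight z = p) :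
    W.cycleClass X p z ∈ W.algebraicLattice X p :=
  AddSubgroup.subset_closure ⟨⟨z, hz⟩, rfl⟩

/-- The class of a codimension-`p` cycle is algebraic (trivially so, with junk value `0`, when
the defining sum is infinite). [folklore] -/
lemma cycleMap_mem_algebraicLattice {c : AlgebraicCycle X.left ℤ}
    (hc : c ∈ cyclesOfCodim X.left p) : W.cycleMap X p c ∈ W.algebraicLattice X p := by
  refine finsum_induction (fun x ↦ x ∈ W.algebraicLattice X p) (zero_mem _)
    (fun _ _ hx hy ↦ add_mem hx hy) fun z ↦ ?_
  by_cases hz : c z = 0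
  · simp [hz]
  · exact AddSubgroup.zsmul_mem _ (W.cycleClass_mem_algebraicLattice X p (hc z hz)) _

end Cycles

/-! ## Correspondences and hyperplane classes -/

section Correspondences

variable {X Y : SchemeOver k}

/-- The linear map `T : Hⁱ(X) →ₗ Hʲ(Y)` *is induced by* the correspondence `u ∈ Hᵐ(X × Y)`
(`nX = dim X`, `nY = dim Y`), in Kleiman's pairing form (Kleiman 1968 §1.3, formula (c)):
for all `x ∈ Hⁱ(X)`, `y ∈ Hʲ'(Y)` with `j + j' = 2 nY`,
`tr_Y (T x ∪ y) = tr_{X×Y} ((pr₁* x ∪ u) ∪ pr₂* y)`.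
Under Poincaré duality this says `T = pr₂₊ (pr₁* (·) ∪ u)`; stated relationally it needs no
axiom. [cite: Kleiman1968, §1.3  formula (c] -/
def IsInducedBy (nX nY : ℕ) {m i j j' : ℕ} (u : W.obj (X ⊗ Y) m)
    (T : W.obj X i →ₗ[K] W.obj Y j) (hj : j + j' = 2 * nY)
    (hm : i + m + j' = 2 * (nX + nY)) : Prop :=
  ∀ (x : W.obj X i) (y : W.obj Y j'),
    W.trace Y nY (W.cup hj (T x) y) =
      W.trace (X ⊗ Y) (nX + nY)
        (W.cup hm (W.cup rfl (W.pullback (fst X Y) i x) u) (W.pullback (snd X Y) j' y))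

variable (X)

/-- `η ∈ H²(X)` *is a hyperplane class*: there is a closed `k`-immersion `ι : X ↪ ℙᴺ_k` and an
effective, nonzero codimension-`1` cycle `D` on `ℙᴺ_k` with `η = ι* cl(D)`.
This is the class of an effective codimension-1 cycle on `ℙᴺ` pulled back along a closed
immersion, i.e. any positive multiple of a hyperplane-section class (an ample class); independence
of B(X) from the choice is a theorem (`standardConjectureB_iff_of_isHyperplaneClass`), not built in.
(Kleiman 1968 §1.4, "the class of a hyperplane section"; Grothendieck 1969.) [cite: Kleiman1968, §1.4  "the class of a hyperplane section] -/
def IsHyperplaneClass (η : W.obj X 2) : Prop :=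
  ∃ (e : ProjectiveEmbedding X) (D : AlgebraicCycle (projectiveSpace e.n k).left ℤ),
    D ∈ cyclesOfCodim (projectiveSpace e.n k).left 1 ∧ 0 < D ∧
      η = W.pullback e.ι 2 (W.cycleMap (projectiveSpace e.n k) 1 D)

end Correspondences

/-! ## Graded operators -/

section Graded

variable (X Y : SchemeOver k)

/-- Graded `K`-linear operators `H•(X) → H•(Y)` of arbitrary (mixed) degree: a family of components
`Hⁱ(X) →ₗ Hʲ(Y)` (Kleiman §1.4: `L`, `Λ`, `ᶜΛ`, the Künneth projectors `πⁱ` are such). [folklore] -/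
abbrev GradedOp : Type u := ∀ i j : ℕ, W.obj X i →ₗ[K] W.obj Y j

variable {X Y} {Z : SchemeOver k}

namespace GradedOp

variable {W}

/-- The graded operator with a single nonzero component `T : Hⁱ(X) →ₗ Hʲ(Y)`. [folklore] -/
def ofLinearMap {i j : ℕ} (T : W.obj X i →ₗ[K] W.obj Y j) : W.GradedOp X Y :=
  fun i' j' ↦ if h : i = i' ∧ j = j' then h.1 ▸ h.2 ▸ T else 0

/-- The `(i, j)` component of `ofLinearMap T` is `T`. [folklore] -/
@[simp]
lemma ofLinearMap_apply_same {i j : ℕ} (T : W.obj X i →ₗ[K] W.obj Y j) :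
    ofLinearMap T i j = T := by
  simp only [ofLinearMap, and_self, ↓reduceDIte]

/-- The other components of `ofLinearMap T` vanish. [folklore] -/
lemma ofLinearMap_apply_of_ne {i j i' j' : ℕ} (T : W.obj X i →ₗ[K] W.obj Y j)
    (h : ¬ (i = i' ∧ j = j')) : ofLinearMap T i' j' = 0 := by
  simp only [ofLinearMap, h, ↓reduceDIte]

/-- Composition of graded operators, `(S ∘ T)ᵢⱼ = ∑ₘ Sₘⱼ ∘ Tᵢₘ`. The sum over the middle degree
is a `finsum` (junk value `0` if infinitely many terms are nonzero; it is finite whenever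
`Hᵐ(Y) = 0` for `m > 2 dim Y`). [folklore] -/
def comp (S : W.GradedOp Y Z) (T : W.GradedOp X Y) : W.GradedOp X Z :=
  fun i j ↦ ∑ᶠ m, (S m j).comp (T i m)

end GradedOp

variable (X)

/-- The Lefschetz operator `L = (· ∪ η) : Hⁱ(X) → Hⁱ⁺²(X)` as a graded operator (components of
degree `≠ 2` are zero) (Kleiman §1.4). [folklore] -/
def lefschetzOp (η : W.obj X 2) : W.GradedOp X X :=
  fun i j ↦ if h : i + 2 = j then W.lefschetzPow X η 1 i j h else 0

variable {X}

/-- A graded operator `T : H•(X) → H•(Y)` (`nX = dim X`, `nY = dim Y`) *is algebraic*: there are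
rational algebraic classes `u_c ∈ A^c(X × Y) ⊗ ℚ` such that each component
`Tᵢⱼ : Hⁱ(X) → Hʲ(Y)` with `j = i + 2c - 2 nX` is induced by the correspondence `u_c`, and the
components in degrees not of this form vanish (Kleiman 1968 §1.4, §2; Grothendieck 1969). [cite: Kleiman1968, §1.4  §2] -/
def IsAlgebraicGradedOp (nX nY : ℕ) (T : W.GradedOp X Y) : Prop :=
  ∃ u : ∀ c : ℕ, ↥(W.ratAlgebraicClasses (X ⊗ Y) c),
    (∀ (i j c j' : ℕ) (hj : j + j' = 2 * nY) (hm : i + 2 * c + j' = 2 * (nX + nY)),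
      2 * c + i = j + 2 * nX → W.IsInducedBy nX nY (u c : W.obj (X ⊗ Y) (2 * c)) (T i j) hj hm) ∧
    (∀ i j : ℕ, (¬ ∃ c : ℕ, 2 * c + i = j + 2 * nX) → T i j = 0)

/-- A single linear map `T : Hⁱ(X) →ₗ Hʲ(Y)` *is algebraic* (induced by an algebraic
correspondence with `ℚ`-coefficients): the graded operator with only component `T` is algebraic
(Kleiman 1968 §1.4, §2). [cite: Kleiman1968, §1.4  §2] -/
def IsAlgebraicOperator (nX nY : ℕ) {i j : ℕ} (T : W.obj X i →ₗ[K] W.obj Y j) : Prop :=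
  W.IsAlgebraicGradedOp nX nY (GradedOp.ofLinearMap T)

end Graded

end PreWeilCohomology

end Literature.AlgebraicGeometry.Motives

end
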